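import Summits.KontsevichZagierPeriods.KontsevichZagierPeriods.Theorems.TerasomaMultiplicationBetaCancellationOneIntegerExponent
import Summits.KontsevichZagierPeriods.KontsevichZagierPeriods.Theorems.TerasomaMultiplicationBetaCancellationOpenCore
import Summits.KontsevichZagierPeriods.KontsevichZagierPeriods.Theorems.TerasomaMultiplicationBetaCancellationStubBetaTranslation

/-!
# `BetaCancellation` (stmt-KontsevichZagierPeriods-13633) — THE OPEN CORE IS THE OPEN TRIANGLE `0 < a ≤ b < 1`; lattice invariance

Line `dirichlet-companion-to-pi`, registered stub `betaCancellation_iff_openTriangle` (helper file,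
`--supports` the crux; namespace `…BetaCancellationLine`; lead seat c13).

With `…OneIntegerExponent` (ONE integer exponent suffices: `β(a,1)`, `β(1,b)` cancel for every positive
rational — the primitive criterion with primitive `t^a/a`) and `…OpenCore` (`BetaCancellation ↔` its
instances on `(0,1]²` `↔` its instance `(1/2,1/2)` `↔` each anti-diagonal instance), this file records:

* `kernelCancellation_betaKernel_of_succ` / `kernelCancellation_betaKernel_succ_iff` /
  `kernelCancellation_betaKernel_add_nat_iff`: **translation is an EQUIVALENCE** of cancellation
  statements (`(a+b)·[β(a,b+1)] ∼ b·[β(a,b)]`, `stub_betaTranslation`, transports certificates BOTH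
  ways; no division in the group is needed, `Negative/Torsion.lean`), so the truth value of the
  instance `(a,b)` of the crux is CONSTANT on the lattice coset `(a + ℕ) × (b + ℕ)`;
* `betaCancellation_iff_openSquare`: **`BetaCancellation ↔` its instances on the OPEN unit square
  `(0,1)² ∩ ℚ²`** (the boundary `a = 1 ∨ b = 1` of the half-open square is PROVED);
* `betaCancellation_iff_openTriangle` (registered stub): by the swap `(a,b) ↔ (b,a)`, **the crux is
  exactly its instances on the triangle `0 < a ≤ b < 1`** — on whose edge `a + b = 1` every single
  instance is already the whole crux (`betaCancellation_iff_antidiagonal`, ≡ item 0540).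

So the tree now decides the crux everywhere the calculus can (one integer exponent: TRUE) and
localises what is open to `{(a,b) ∈ ℚ² | 0 < a ≤ b < 1}` modulo `ℤ²`-translation and the swap.
-/

noncomputable section

-- `Summit.KontsevichZagierPeriods.KontsevichZagierPeriods.…` is the tree's mandated layout (single-conjunct summit).
set_option linter.dupNamespace false

namespace Summit.KontsevichZagierPeriods.KontsevichZagierPeriods.BetaCancellationLine

open MeasureTheory Set
open Literature.NumberTheory.Transcendental
open Literature.NumberTheory.Transcendental.KZ
open Summit.KontsevichZagierPeriods.KontsevichZagierPeriods.Theses.TerasomaMultiplication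
  (BetaCancellation)
open Summit.KontsevichZagierPeriods.KontsevichZagierPeriods.BetaCancellationNegative
open Summit.KontsevichZagierPeriods.GammaHodgeSectorKO (betaRep betaRep_domain betaRep_integrand)
open Summit.KontsevichZagierPeriods.TerasomaMultiplication.GammaHodgeFromRelators (isAlgebraic_ratCast)

/-! ## Translation is an equivalence -/

/-- **Converse translation `KernelCancellation (β(a,b+1)) → KernelCancellation (β(a,b))`**: the
two-term identity `(a+b)·[β(a,b+1)] ∼ b·[β(a,b)]` (`stub_betaTranslation`) transports a pinned
equivalence over `(a,b)` to one over `(a,b+1)`, scaled by the non-zero algebraic constant `a + b`,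
which cancels (`equivalent_of_equivalent_constMul`). [folklore] -/
theorem kernelCancellation_betaKernel_of_succ {a b : ℚ} (ha : 0 < a) (hb : 0 < b)
    (h : KernelCancellation (betaKernel a (b + 1))) : KernelCancellation (betaKernel a b) := by
  intro n m r r' q q' hq hq' hqq'
  have hb1 : 0 < b + 1 := by linarith
  have hab : IsAlgebraic ℚ ((a:ℝ) + b) := by
    have := isAlgebraic_ratCast (a + b)
    push_cast at this
    exact this
  have hab0 : (a:ℝ) + b ≠ 0 := by positivity
  have hbalg : IsAlgebraic ℚ ((b:ℚ):ℝ) := isAlgebraic_ratCast b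
  set ρ := (betaRep a (b + 1) ha hb1).constMul ((a:ℝ) + b) hab with hρ
  set ρ' := (betaRep a b ha hb).constMul ((b:ℚ):ℝ) hbalg with hρ'
  have hρρ' : Equivalent ρ ρ' := by
    refine stub_betaTranslation a b ha hb ρ ρ' rfl (fun x _ => ?_) rfl (fun x _ => ?_)
    · simp only [hρ, IntegralRep.integrand_constMul, betaRep_integrand, betaKernel, cast_add_one_sub_one]
    · simp only [hρ', IntegralRep.integrand_constMul, betaRep_integrand, betaKernel]
  -- from `(a,b)`-pinned data to `(a,b+1)`-products, scaled by `a + b`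
  have chain : ∀ {k : ℕ} (σ : IntegralRep k) (p : IntegralRep (1 + k)),
      IsPinned (betaKernel a b) σ p →
      Equivalent (p.constMul ((b:ℚ):ℝ) hbalg)
        (((betaRep a (b + 1) ha hb1).prod σ).constMul ((a:ℝ) + b) hab) := by
    intro k σ p hp
    have e1 := (equivalent_betaRep_prod_of_isPinned ha hb hp).constMul ((b:ℚ):ℝ) hbalg
    rw [← constMul_prod_eq] at e1
    have e2 : Equivalent (ρ'.prod σ) (ρ.prod σ) := Equivalent.prod hρρ'.symm (Equivalent.refl σ)
    rw [hρ, constMul_prod_eq (betaRep a (b + 1) ha hb1) σ hab] at e2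
    exact e1.trans e2
  have h1 := ((chain r q hq).symm.trans (hqq'.constMul _ hbalg)).trans (chain r' q' hq')
  have h2 := equivalent_of_equivalent_constMul hab hab0 h1
  exact h r r' _ _ (isPinned_betaRep_prod a (b + 1) ha hb1 r) (isPinned_betaRep_prod a (b + 1) ha hb1 r') h2

/-- **Translation is an equivalence**: `KernelCancellation (β(a,b)) ↔ KernelCancellation (β(a,b+1))`.
[folklore] -/
theorem kernelCancellation_betaKernel_succ_iff {a b : ℚ} (ha : 0 < a) (hb : 0 < b) :
    KernelCancellation (betaKernel a b) ↔ KernelCancellation (betaKernel a (b + 1)) :=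
  ⟨kernelCancellation_betaKernel_succ ha hb, kernelCancellation_betaKernel_of_succ ha hb⟩

/-- **Lattice invariance**: the truth value of the instance `(a,b)` of the crux is constant on the coset
`(a + ℕ) × (b + ℕ)`: `KernelCancellation (β(a+A, b+B)) ↔ KernelCancellation (β(a,b))`. [folklore] -/
theorem kernelCancellation_betaKernel_add_nat_iff {a b : ℚ} (ha : 0 < a) (hb : 0 < b) (A B : ℕ) :
    KernelCancellation (betaKernel (a + A) (b + B)) ↔ KernelCancellation (betaKernel a b) := by
  have hbB : ∀ B : ℕ, KernelCancellation (betaKernel a (b + B)) ↔ KernelCancellation (betaKernel a b) := by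
    intro B
    induction B with
    | zero => simp
    | succ B ih =>
      rw [← ih, kernelCancellation_betaKernel_succ_iff (b := b + B) ha (by positivity)]
      push_cast
      rw [add_assoc]
  have haA : ∀ (b' : ℚ), 0 < b' → ∀ A : ℕ,
      KernelCancellation (betaKernel (a + A) b') ↔ KernelCancellation (betaKernel a b') := by
    intro b' hb' A
    induction A with
    | zero => simp
    | succ A ih =>
      rw [← ih]
      have hA : 0 < a + A := by positivity
      constructor
      · intro h
        have h' := kernelCancellation_betaKernel_symm hb' (by positivity) h
        push_cast at h'
        rw [← add_assoc] at h'
        exact kernelCancellation_betaKernel_symm hA hb'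
          (kernelCancellation_betaKernel_of_succ hb' hA h')
      · intro h
        have h' := kernelCancellation_betaKernel_succ hb' hA (kernelCancellation_betaKernel_symm hb' hA h)
        have h'' := kernelCancellation_betaKernel_symm (by positivity) hb' h'
        push_cast
        rwa [← add_assoc]
  rw [haA (b + B) (by positivity) A, hbB B]

/-- **Every instance on an anti-diagonal coset is the whole crux**: for `0 < a₀ < 1` and `A, B ∈ ℕ`,
`BetaCancellation ↔ KernelCancellation (β(a₀ + A, 1 − a₀ + B))` — lattice invariance down to
`(a₀, 1 − a₀)`, where Euler reflection makes the instance `π`-cancellation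
(`betaCancellation_iff_antidiagonal`). E.g. `(1/2, 3/2)`, `(4/3, 2/3)`, `(1/2,1/2)` (item 0540). [folklore] -/
theorem betaCancellation_iff_of_antidiagonal_coset {a₀ : ℚ} (h0 : 0 < a₀) (h1 : a₀ < 1) (A B : ℕ) :
    BetaCancellation ↔ KernelCancellation (betaKernel (a₀ + A) (1 - a₀ + B)) := by
  rw [kernelCancellation_betaKernel_add_nat_iff h0 (by linarith) A B]
  exact betaCancellation_iff_antidiagonal h0 h1

/-! ## The open core: the open square, the open triangle -/

/-- **`BetaCancellation ↔` its instances on the OPEN unit square `(0,1)² ∩ ℚ²`.** The boundary of the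
half-open square of `betaCancellation_iff_unitSquare` is proved: `β(a,1)`, `β(1,b)` cancel for every
positive rational `a`, `b` (`kernelCancellation_betaKernel_rat_one`, `kernelCancellation_betaKernel_one_rat`).
[folklore] -/
theorem betaCancellation_iff_openSquare :
    BetaCancellation ↔ ∀ a b : ℚ, 0 < a → a < 1 → 0 < b → b < 1 → KernelCancellation (betaKernel a b) := by
  rw [betaCancellation_iff_unitSquare]
  refine ⟨fun h a b ha ha1 hb hb1 => h a b ha ha1.le hb hb1.le, fun h a b ha ha1 hb hb1 => ?_⟩
  rcases ha1.lt_or_eq with ha1 | rfl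
  · rcases hb1.lt_or_eq with hb1 | rfl
    · exact h a b ha ha1 hb hb1
    · exact kernelCancellation_betaKernel_rat_one ha
  · exact kernelCancellation_betaKernel_one_rat hb

/-- **STUB `betaCancellation_iff_openTriangle`** (registered on the crux item): **the crux is exactly
its instances on the triangle `0 < a ≤ b < 1`** (open square + the swap
`kernelCancellation_betaKernel_symm`). On its edge `a + b = 1` each single instance is already the
whole crux (`betaCancellation_iff_antidiagonal`, ≡ item 0540, open). [folklore] -/
theorem betaCancellation_iff_openTriangle :
    Summit.KontsevichZagierPeriods.KontsevichZagierPeriods.Theses.TerasomaMultiplication.BetaCancellation ↔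
      ∀ a b : ℚ, 0 < a → a ≤ b → b < 1 → KernelCancellation (betaKernel a b) := by
  rw [betaCancellation_iff_openSquare]
  refine ⟨fun h a b ha hab hb1 => h a b ha (lt_of_le_of_lt hab hb1) (lt_of_lt_of_le ha hab) hb1,
    fun h a b ha ha1 hb hb1 => ?_⟩
  rcases le_total a b with hab | hba
  · exact h a b ha hab hb1
  · exact kernelCancellation_betaKernel_symm ha hb (h b a hb hba ha1)

end Summit.KontsevichZagierPeriods.KontsevichZagierPeriods.BetaCancellationLine
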